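import Summits.QuantumAdvantage.QuantumAdvantage.Theorems.ArithStatLadderIqThreeNotPPolyApexAC0
import Summits.QuantumAdvantage.QuantumAdvantage.Theorems.ArithStatLadderIqThreeNotPPolyStubShiftPairsCountFive
import Summits.QuantumAdvantage.QuantumAdvantage.Theorems.IqThreeNotPPoly.Negative.GenusTwoParity

/-!
# Crux `ArithStatLadder.IqThreeNotPPoly` (stmt-QuantumAdvantage-2422): the `ℓ = 2` analogue of the crux HOLDS against `AC⁰`

The crux is `IQ3 = bin {d : −d fundamental ∧ 3 ∣ h(−d)} ∉ P/poly` (hypothesis-type). Its `ℓ = 2`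
analogue `IQ2 = bin {d : −d fundamental ∧ 2 ∣ h(−d)} ∉ P/poly` was shown by the crux's disprover
to collapse, through Gauss's genus theory, to fundamentality recognition
(`Negative/GenusTwoParity.lean`, `Negative/GenusTwoCollapse.lean`: for fundamental `−d`,
`2 ∣ h(−d) ↔ ¬(d = 4 ∨ d = 8 ∨ d prime)`), which is again hypothesis-type at the `P/poly` level.
ONE LEVEL DOWN IT IS A THEOREM:

* `iqTwo_not_mem_AC0` — **`bin {d : −d fundamental ∧ 2 ∣ h(−d)} ∉ AC⁰`**, unconditionally.

Proof: the generic average-sensitivity core `not_mem_AC0_of_sensitive_numerals` of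
`ArithStatLadderIqThreeNotPPolyApexAC0.lean` (R1 `stub_influenceTail` + R2 `stub_influenceAC0`:
constant-depth polynomial-size circuits have total influence `o(n)`, from A. Tal's Fourier tails
PROVED in the tree; R4 `stub_shiftPairsCube`: numerals ↔ cube) fed with the wave-2 rung stub R5
`stub_shiftPairsCountFive`: for `n ≥ n₀` and `n/2 + 12 ≤ j ≤ n − 2` there are `≥ 2ⁿ/16384` numerals
`N ∈ [2^{n-1}, 2ⁿ)`, `N ≡ 3 (4)`, bit `j` zero, `N` squarefree, `5 ∣ N`, `9 ∣ N + 2ʲ`. Such an `N` is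
a fundamental `−N` (`N ≡ 3 (4)` squarefree) which is composite (`5 ∣ N`, `N ≠ 5`), so `2 ∣ h(−N)`
by genus theory (`Negative.two_dvd_classNumber_iff_not`), i.e. `N ∈ IQ2`; and `N + 2ʲ ≡ 3 (4)` is a
multiple of `9`, hence not squarefree, hence `−(N + 2ʲ)` is not fundamental and `N + 2ʲ ∉ IQ2`.

So along the ArithStatLadder the picture is now kernel-checked at both ends: the worst-case apex
`X` (and its squarefree apex) are of separation strength (`⇒ P^{#P} ⊄ P/poly`, `⇒ NP ⊄ P/poly`),
while the constant-depth shadows of the squarefree apex, of `FUND`, and of the `ℓ = 2` twin of `X`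
are THEOREMS (`squarefree_not_mem_AC0`, `fund_not_mem_AC0`, `iqTwo_not_mem_AC0`).

## References

* A. Bernasconi, C. Damm, I. E. Shparlinski, *The average sensitivity of square-freeness*,
  Comput. Complexity 9 (2000) 39–51 [BernasconiDammShparlinski2000].
* R. B. Boppana, *The average sensitivity of bounded-depth circuits*, IPL 63 (1997) [Boppana1997].
* A. Tal, *Tight bounds on the Fourier spectrum of AC⁰*, CCC 2017, Thm. 3.6 [Tal2017].
* D. A. Cox, *Primes of the form x² + ny²*, 2nd ed., Wiley 2013, Thm. 3.15 / §6 (genus theory) [Cox2013].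
-/

set_option linter.dupNamespace false -- D-0017: single-problem summit ⇒ `QuantumAdvantage.QuantumAdvantage` by design

noncomputable section

namespace Summit.QuantumAdvantage.QuantumAdvantage.Theorems.IqThreeNotPPoly

open scoped Classical BigOperators
open _root_.Computability
open Literature.Computability.Complexity
open Literature.Computability.Cryptography (IsNegFundamentalDiscr)
open Literature.NumberTheory.QuadraticFields (BinaryQuadraticForm.classNumber)

/-- The shifted-pair set of R5 (`stub_shiftPairsCountFive`) consists of sensitive numerals of `bin A`
for any `A ⊆ ℕ` sandwiched as `{N ≡ 3 (4), N squarefree, 5 ∣ N} ⊆ A` and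
`A ∩ {N ≡ 3 (4)} ⊆ {squarefree}` (for `j ≥ 2`: `N + 2ʲ ≡ 3 (4)` with `9 ∣ N + 2ʲ` is not
squarefree, so `∉ A`). [folklore] -/
theorem shiftFive_subset_sensitive (A : Set ℕ)
    (hin : ∀ N : ℕ, N % 4 = 3 → Squarefree N → 5 ∣ N → N ∈ A)
    (hout : ∀ N : ℕ, N % 4 = 3 → N ∈ A → Squarefree N) (n j : ℕ) (hj : 2 ≤ j) :
    (Finset.range (2 ^ n)).filter (fun N : ℕ =>
        2 ^ (n - 1) ≤ N ∧ N % 4 = 3 ∧ N.testBit j = false ∧ Squarefree N ∧ 5 ∣ N ∧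
          9 ∣ N + 2 ^ j) ⊆
      (Finset.range (2 ^ n)).filter (fun N : ℕ =>
        2 ^ (n - 1) ≤ N ∧ N.testBit j = false ∧ N ∈ A ∧ N + 2 ^ j ∉ A) := by
  intro N hN
  simp only [Finset.mem_filter] at hN ⊢
  obtain ⟨hr, h1, hm4, h3, hsq, h5, h9⟩ := hN
  refine ⟨hr, h1, h3, hin N hm4 hsq h5, fun hmem => ?_⟩
  have h4j : 4 ∣ 2 ^ j := by
    obtain ⟨t, ht⟩ := Nat.exists_eq_add_of_le hj
    exact Dvd.intro (2 ^ t) (by rw [ht, pow_add]; norm_num)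
  have hm4' : (N + 2 ^ j) % 4 = 3 := by
    obtain ⟨t, ht⟩ := h4j
    omega
  exact apexAC0_not_squarefree_of_nine_dvd h9 (hout _ hm4' hmem)

/-- **Sandwich form with a planted factor `5`**: any `A ⊆ ℕ` with
`{N ≡ 3 (4), N squarefree, 5 ∣ N} ⊆ A` and `A ∩ {N ≡ 3 (4)} ⊆ {squarefree}` has `bin A ∉ AC⁰`
(generic core `not_mem_AC0_of_sensitive_numerals` with `K = 16384`, `w = 24` + R5
`stub_shiftPairsCountFive`; positions below `2` never occur since `j ≥ n/2 + 12`).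
[cite: BernasconiDammShparlinski2000, §1 (main theorem)] -/
theorem not_mem_AC0_of_shiftFive (A : Set ℕ)
    (hin : ∀ N : ℕ, N % 4 = 3 → Squarefree N → 5 ∣ N → N ∈ A)
    (hout : ∀ N : ℕ, N % 4 = 3 → N ∈ A → Squarefree N) :
    encodingNatBool.toLanguage A ∉ AC0 := by
  refine not_mem_AC0_of_sensitive_numerals A 16384 24 (by norm_num)
    (fun n j => if 2 ≤ j then (Finset.range (2 ^ n)).filter (fun N : ℕ =>
        2 ^ (n - 1) ≤ N ∧ N % 4 = 3 ∧ N.testBit j = false ∧ Squarefree N ∧ 5 ∣ N ∧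
          9 ∣ N + 2 ^ j) else ∅)
    (fun n j => ?_) ?_
  · by_cases hj : 2 ≤ j
    · rw [if_pos hj]; exact shiftFive_subset_sensitive A hin hout n j hj
    · rw [if_neg hj]; exact Finset.empty_subset _
  · obtain ⟨n₀, h⟩ := stub_shiftPairsCountFive
    refine ⟨n₀, fun n hn j hj1 hj2 => ?_⟩
    rw [if_pos (by omega)]
    convert h n hn j hj1 hj2 using 5

/-- **The `ℓ = 2` analogue of the crux holds against `AC⁰`:
`bin {d : −d fundamental ∧ 2 ∣ h(−d)} ∉ AC⁰`** — unconditional. The sandwich of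
`not_mem_AC0_of_shiftFive`: a squarefree `N ≡ 3 (4)` is a fundamental `−N`
(`isNegFundamentalDiscr_iff_squarefree_of_mod_four`), and `5 ∣ N` makes it composite (`N ≠ 5` as
`5 ≢ 3 (4)`) and `≠ 4, 8`, so `2 ∣ h(−N)` by genus theory (`Negative.two_dvd_classNumber_iff_not`);
conversely membership forces fundamentality, hence squarefreeness on `N ≡ 3 (4)`.
[cite: BernasconiDammShparlinski2000, §1 (main theorem)] [cite: Cox2013, Thm. 3.15] -/
theorem iqTwo_not_mem_AC0 :
    encodingNatBool.toLanguage
      {d : ℕ | IsNegFundamentalDiscr d ∧ 2 ∣ BinaryQuadraticForm.classNumber (-(d : ℤ))} ∉ AC0 := by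
  refine not_mem_AC0_of_shiftFive _ (fun N hm4 hsq h5 => ?_) (fun N hm4 hmem => ?_)
  · have hF : IsNegFundamentalDiscr N := (isNegFundamentalDiscr_iff_squarefree_of_mod_four hm4).2 hsq
    refine ⟨hF, (Negative.two_dvd_classNumber_iff_not hF).2 ?_⟩
    rintro (h | h | hp)
    · omega
    · omega
    · have h5' := Nat.Prime.eq_one_or_self_of_dvd hp 5 h5
      omega
  · exact (isNegFundamentalDiscr_iff_squarefree_of_mod_four hm4).1 hmem.1

/-- The `P/poly`-level statement the theorem shadows: with the disprover's genus collapse the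
`ℓ = 2` analogue of `X` is `FUND ∉ P/poly`, hypothesis-type; the `AC⁰` shadow above is proved.
Formally `AC⁰ ⊆ P/poly` transfers any `P/poly` lower bound for `IQ2` down to this one.
[cite: AroraBarak2009, §14.1] -/
theorem iqTwo_not_mem_AC0_of_not_mem_PPoly
    (h : encodingNatBool.toLanguage
      {d : ℕ | IsNegFundamentalDiscr d ∧ 2 ∣ BinaryQuadraticForm.classNumber (-(d : ℤ))} ∉ PPoly) :
    encodingNatBool.toLanguage
      {d : ℕ | IsNegFundamentalDiscr d ∧ 2 ∣ BinaryQuadraticForm.classNumber (-(d : ℤ))} ∉ AC0 :=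
  fun hA => h (AC0Mod_subset_PPoly two_pos (AC0_subset_AC0Mod 2 hA))

end Summit.QuantumAdvantage.QuantumAdvantage.Theorems.IqThreeNotPPoly

end
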